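import Literature.AlgebraicGeometry.Resolution.RegularHomComposition
import Literature.AlgebraicGeometry.Resolution.AdicQuotient
import Literature.RingTheory.Flat.LocalCriterion
import Mathlib.RingTheory.Localization.BaseChange
import Mathlib.RingTheory.Flat.FaithfullyFlat.Algebra
import HarnessLib

/-!
# Regular homomorphisms and localisation; flatness of the completed map of a flat local homomorphism

Topic: `Literature/AlgebraicGeometry/Resolution`. Two further elementary inputs of Matsumura's
§32 (Thms. 32.2 (ii), 32.4 = Stacks 07PT) and of Grothendieck's theorem on G-rings (Stacks 07PV),
PROVED (no new notions, no named facts):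

* **Localisations are regular homomorphisms and regular homomorphisms may be localised** (Stacks
  07PT, proof: "The localization `R_𝔪^∧ → (R_𝔪^∧)_{𝔭'}` is regular … Since it factors through the
  localization `R_𝔭`, also the ring map `R_𝔭 → (R_𝔪^∧)_{𝔭'}^∧` is regular"):
  `IsRegularHom.of_algEquiv` (transport along an `A`-algebra isomorphism of the target),
  `isRegularHom_of_isLocalization` (`A → M⁻¹A` is regular: flat, and the fibres `L ⊗_A M⁻¹A` are
  localisations of the fields `L`), `IsRegularHom.of_isLocalization_left` (if `A → X` is regular
  and factors through `R = M⁻¹A` then `R → X` is regular: `X = R ⊗_A X` and `R` is quasi-finite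
  over `A`, `IsRegularHom.baseChange_of_quasiFinite`), `IsRegularHom.comp_isLocalization_right`
  (`A → B` regular, `C = T⁻¹B` ⇒ `A → C` regular, by Thm. 32.1 (i)).
* **The completed map of a flat local homomorphism is faithfully flat** (Matsumura, Thm. 22.4 (i):
  for a local homomorphism `(A, 𝔪) → (B, 𝔫)` of Noetherian local rings and a finite `B`-module
  `M`, "`M` is flat over `A` ⟺ `M*` is flat over `A` ⟺ `M*` is flat over `A*`", here `M = B`,
  direction ⇒; used in the proof of Thm. 32.2 (ii): "`f*` is faithfully flat"):
  `isLocalHom_adicCompletionMap`, `flat_adicCompletionMap`, `faithfullyFlat_adicCompletionMap` for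
  `f^ = adicCompletionMap 𝔪_R 𝔪_S f` (`AdicQuotient.lean`). Proof of flatness by the local
  criterion (Matsumura Thm. 22.3 / Stacks 00MK, `Literature.RingTheory.Flat.LocalCriterion`): it
  suffices that `S^ ⊗_{R^} 𝔪_{R^} → S^` be injective; since `𝔪_{R^} = 𝔪_R R^` every element of
  `S^ ⊗_{R^} 𝔪_{R^}` comes from `S^ ⊗_R 𝔪_R`, on which the map is `S^ ⊗_R 𝔪_R → S^`, injective
  because `S^` is flat over `S`, hence over `R`.

## Sources

* H. Matsumura, *Commutative Ring Theory*, CUP 1986: Thm. 22.3 and Thm. 22.4 (i), pp. 174–177;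
  Thm. 32.1, Thm. 32.2 (ii) and its proof ("`f^*` is faithfully flat"), p. 257 [PDF 275].
  [Matsumura1987]
* The Stacks Project, Tag 07PT (Lemma 15.51.7) and its proof; Tag 00MK. [StacksProject]
-/

noncomputable section

open IsLocalRing TensorProduct

namespace Literature.AlgebraicGeometry.Resolution

universe u

/-! ## Regular homomorphisms and localisation -/

section Localization

variable {A B : Type u} [CommRing A] [CommRing B] [Algebra A B]

/-- Regularity of `A → B` is invariant under `A`-algebra isomorphisms of `B` (flatness and the
fibres `L ⊗_{κ(𝔭)} (κ(𝔭) ⊗_A B)` are transported). [folklore] -/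
theorem IsRegularHom.of_algEquiv {B' : Type u} [CommRing B'] [Algebra A B'] (e : B ≃ₐ[A] B')
    (h : IsRegularHom A B) : IsRegularHom A B' := by
  haveI : Module.Flat A B := h.1
  refine ⟨Module.Flat.of_linearEquiv e.symm.toLinearEquiv, fun p _ => ?_⟩
  intro L _ _ hL
  haveI : IsRegularRing (L ⊗[p.ResidueField] (p.ResidueField ⊗[A] B)) := h.2 p L hL
  let e₁ : p.ResidueField ⊗[A] B' ≃ₐ[p.ResidueField] p.ResidueField ⊗[A] B :=
    Algebra.TensorProduct.congr AlgEquiv.refl e.symm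
  let e₂ : L ⊗[p.ResidueField] (p.ResidueField ⊗[A] B') ≃ₐ[L]
      L ⊗[p.ResidueField] (p.ResidueField ⊗[A] B) :=
    Algebra.TensorProduct.congr AlgEquiv.refl e₁
  exact IsRegularRing.of_ringEquiv (R := L ⊗[p.ResidueField] (p.ResidueField ⊗[A] B))
    e₂.symm.toRingEquiv

/-- **A localisation `A → M⁻¹A` is a regular homomorphism** (Stacks 07PT, proof: "The
localization `R_𝔪^∧ → (R_𝔪^∧)_{𝔭'}` is regular"): it is flat, and for a prime `𝔭` and a finite
extension `L` of `κ(𝔭)` the ring `L ⊗_{κ(𝔭)} (κ(𝔭) ⊗_A M⁻¹A) ≅ L ⊗_A M⁻¹A` is a localisation of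
the field `L`, hence regular. [cite: StacksProject, Tag 07PT (proof)] -/
theorem isRegularHom_of_isLocalization (M : Submonoid A) [IsLocalization M B] :
    IsRegularHom A B := by
  refine ⟨IsLocalization.flat B M, fun p _ => ?_⟩
  intro L _ _ hL
  letI : Algebra A L := ((algebraMap p.ResidueField L).comp (algebraMap A p.ResidueField)).toAlgebra
  haveI : IsScalarTower A p.ResidueField L := IsScalarTower.of_algebraMap_eq fun _ => rfl
  haveI : IsLocalization (Algebra.algebraMapSubmonoid L M) (L ⊗[A] B) := inferInstance
  haveI : IsRegularRing (L ⊗[A] B) :=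
    isRegularRing_of_isLocalization (Algebra.algebraMapSubmonoid L M) (L ⊗[A] B)
  exact IsRegularRing.of_ringEquiv (R := L ⊗[A] B)
    (Algebra.TensorProduct.cancelBaseChange A p.ResidueField L L B).symm.toRingEquiv

/-- **A regular homomorphism factoring through a localisation of its source stays regular from
the localisation** (Stacks 07PT, proof: "Since it factors through the localization `R_𝔭`, also
the ring map `R_𝔭 → (R_𝔪^∧)_{𝔭'}^∧` is regular"): for `R = M⁻¹A` and an `R`-algebra `X`
regular over `A`, `X` is regular over `R` — `R` is quasi-finite over `A`, so `R → R ⊗_A X` is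
regular (`IsRegularHom.baseChange_of_quasiFinite`), and `R ⊗_A X ≅ X` over `R`.
[cite: StacksProject, Tag 07PT (proof)] -/
theorem IsRegularHom.of_isLocalization_left (M : Submonoid A) (R X : Type u) [CommRing R]
    [CommRing X] [Algebra A R] [IsLocalization M R] [Algebra R X] [Algebra A X]
    [IsScalarTower A R X] (h : IsRegularHom A X) : IsRegularHom R X := by
  haveI : Algebra.QuasiFinite A R := Algebra.QuasiFinite.of_isLocalization (S := A) M
  have h' : IsRegularHom R (R ⊗[A] X) := h.baseChange_of_quasiFinite R
  exact h'.of_algEquiv (IsLocalization.algebraLid M R X)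

/-- **Localising the target of a regular homomorphism** (of Noetherian rings): if `A → B` is
regular and `C = T⁻¹B` then `A → C` is regular (Thm. 32.1 (i) with
`isRegularHom_of_isLocalization`). [cite: Matsumura1987, Thm. 32.1 (i)] -/
theorem IsRegularHom.comp_isLocalization_right [IsNoetherianRing B] (h : IsRegularHom A B)
    (T : Submonoid B) (C : Type u) [CommRing C] [Algebra B C] [IsLocalization T C] [Algebra A C]
    [IsScalarTower A B C] : IsRegularHom A C :=
  haveI : IsNoetherianRing C := IsLocalization.isNoetherianRing T C inferInstance
  h.comp (isRegularHom_of_isLocalization T)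

end Localization

/-! ## The completed map of a flat local homomorphism is faithfully flat (Matsumura 22.4 (i)) -/

section CompletedMap

variable {R S : Type u} [CommRing R] [CommRing S] [IsLocalRing R] [IsLocalRing S]
  [IsNoetherianRing R] [IsNoetherianRing S] [Algebra R S]

omit [IsNoetherianRing R] [IsNoetherianRing S] in
/-- For a local homomorphism, `𝔪_R S ⊆ 𝔪_S` (the hypothesis of `adicCompletionMap`). [folklore] -/
theorem map_maximalIdeal_le_of_isLocalHom [IsLocalHom (algebraMap R S)] :
    (maximalIdeal R).map (algebraMap R S) ≤ maximalIdeal S :=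
  ((IsLocalRing.local_hom_TFAE (algebraMap R S)).out 0 2).mp ‹_›

omit [IsNoetherianRing R] [IsNoetherianRing S] in
/-- The completed map `f^ : R^ → S^` extends `f`: `f^ ∘ (R → R^) = (S → S^) ∘ f`. [folklore] -/
theorem adicCompletionMap_comp_algebraMap (h : (maximalIdeal R).map (algebraMap R S) ≤ maximalIdeal S) :
    (adicCompletionMap (maximalIdeal R) (maximalIdeal S) (algebraMap R S) h).comp
        (algebraMap R (AdicCompletion (maximalIdeal R) R)) =
      (algebraMap S (AdicCompletion (maximalIdeal S) S)).comp (algebraMap R S) := by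
  refine RingHom.ext fun r => ?_
  simp only [RingHom.comp_apply, AdicCompletion.algebraMap_apply, Algebra.algebraMap_self,
    RingHom.id_apply, adicCompletionMap_of]

/-- **The completed map of a local homomorphism is local**: `f^(𝔪_R R^) ⊆ 𝔪_S S^`.
[cite: Matsumura1987, Thm. 32.2 (ii), proof] -/
theorem isLocalHom_adicCompletionMap (h : (maximalIdeal R).map (algebraMap R S) ≤ maximalIdeal S) :
    IsLocalHom (adicCompletionMap (maximalIdeal R) (maximalIdeal S) (algebraMap R S) h) := by
  apply ((IsLocalRing.local_hom_TFAE _).out 0 2).mpr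
  rw [AdicCompletion.maximalIdeal_eq_map, AdicCompletion.maximalIdeal_eq_map, Ideal.map_map,
    adicCompletionMap_comp_algebraMap h, ← Ideal.map_map]
  exact Ideal.map_mono h

/-- **Matsumura, Thm. 22.4 (i)** (the case `M = B`, direction "`M` flat over `A` ⇒ `M*` flat
over `A*`"): for a flat local homomorphism `f : R → S` of Noetherian local rings the completed
map `f^ : R^ → S^` is flat. Proof by the local flatness criterion (Thm. 22.3 (3) ⇒ (1), Stacks
00MK) for the finite `S^`-module `S^` over the local homomorphism `R^ → S^`: it suffices that
`S^ ⊗_{R^} 𝔪_{R^} → S^` be injective. As `𝔪_{R^} = 𝔪_R R^` is generated by the image of a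
generating family `v` of `𝔪_R`, every element of `S^ ⊗_{R^} 𝔪_{R^}` is the image of an element of
`S^ ⊗_R 𝔪_R` under `s ⊗ x ↦ s ⊗ x`; on `S^ ⊗_R 𝔪_R` the map in question is the multiplication
map `S^ ⊗_R 𝔪_R → S^`, injective since `S^` is flat over `S` and `S` is flat over `R`.
[cite: Matsumura1987, Thm. 22.4 (i)] -/
theorem flat_adicCompletionMap [Module.Flat R S]
    (h : (maximalIdeal R).map (algebraMap R S) ≤ maximalIdeal S) :
    (adicCompletionMap (maximalIdeal R) (maximalIdeal S) (algebraMap R S) h).Flat := by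
  set fh := adicCompletionMap (maximalIdeal R) (maximalIdeal S) (algebraMap R S) h with hfh
  letI : Algebra (AdicCompletion (maximalIdeal R) R) (AdicCompletion (maximalIdeal S) S) :=
    fh.toAlgebra
  -- the three algebra structures `R → R^ → S^`, `R → S → S^` are compatible
  haveI : IsScalarTower R S (AdicCompletion (maximalIdeal S) S) :=
    IsScalarTower.of_algebraMap_eq fun _ => rfl
  haveI : IsScalarTower R (AdicCompletion (maximalIdeal R) R) (AdicCompletion (maximalIdeal S) S) :=
    IsScalarTower.of_algebraMap_eq fun r =>
      show algebraMap R (AdicCompletion (maximalIdeal S) S) r =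
          fh (algebraMap R (AdicCompletion (maximalIdeal R) R) r) from
        (RingHom.congr_fun (adicCompletionMap_comp_algebraMap h) r).symm
  haveI : Module.Flat R (AdicCompletion (maximalIdeal S) S) :=
    Module.Flat.trans R S (AdicCompletion (maximalIdeal S) S)
  haveI : IsNoetherianRing (AdicCompletion (maximalIdeal R) R) :=
    isNoetherianRing_adicCompletion_maximalIdeal R
  haveI : IsNoetherianRing (AdicCompletion (maximalIdeal S) S) :=
    isNoetherianRing_adicCompletion_maximalIdeal S
  haveI : IsLocalHom (algebraMap (AdicCompletion (maximalIdeal R) R)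
      (AdicCompletion (maximalIdeal S) S)) := isLocalHom_adicCompletionMap h
  change Module.Flat (AdicCompletion (maximalIdeal R) R) (AdicCompletion (maximalIdeal S) S)
  apply Literature.RingTheory.Flat.flat_of_injective_lTensor_maximalIdeal
    (A := AdicCompletion (maximalIdeal R) R) (B := AdicCompletion (maximalIdeal S) S)
    (M := AdicCompletion (maximalIdeal S) S)
  -- notation
  set Rh := AdicCompletion (maximalIdeal R) R
  set Sh := AdicCompletion (maximalIdeal S) S
  -- generators `v` of `𝔪_R`; their images generate `𝔪_{R^}`
  obtain ⟨n, v, hv⟩ := Submodule.fg_iff_exists_fin_generating_family.mp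
    (maximalIdeal R).fg_of_isNoetherianRing
  have hvmem : ∀ i, v i ∈ maximalIdeal R := fun i => hv ▸ Submodule.subset_span ⟨i, rfl⟩
  have hgen : maximalIdeal Rh = Ideal.span (Set.range fun i => algebraMap R Rh (v i)) := by
    have e1 : Ideal.map (algebraMap R Rh) (maximalIdeal R) =
        Ideal.map (algebraMap R Rh) (Ideal.span (Set.range v)) :=
      congrArg (Ideal.map (algebraMap R Rh)) hv.symm
    rw [AdicCompletion.maximalIdeal_eq_map, e1, Ideal.map_span, ← Set.range_comp]
    rfl
  -- `ι : 𝔪_R → 𝔪_{R^}` and `ψ : S^ ⊗_R 𝔪_R → S^ ⊗_{R^} 𝔪_{R^}`, `s ⊗ x ↦ s ⊗ x`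
  have hιmem : ∀ x : maximalIdeal R, algebraMap R Rh x ∈ maximalIdeal Rh := fun x => by
    rw [AdicCompletion.maximalIdeal_eq_map]
    exact Ideal.mem_map_of_mem _ x.2
  let ι : maximalIdeal R →ₗ[R] maximalIdeal Rh :=
    { toFun := fun x => ⟨algebraMap R Rh x, hιmem x⟩
      map_add' := fun x y => Subtype.ext (by simp)
      map_smul' := fun r x => Subtype.ext (by simp [Algebra.smul_def]) }
  have hι : ∀ x : maximalIdeal R, ((ι x : maximalIdeal Rh) : Rh) = algebraMap R Rh x := fun _ => rfl
  let ψ : Sh ⊗[R] maximalIdeal R →ₗ[Rh] Sh ⊗[Rh] maximalIdeal Rh :=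
    (LinearMap.lTensor Sh (ι.liftBaseChange Rh)) ∘ₗ
      (TensorProduct.AlgebraTensorModule.cancelBaseChange R Rh Rh Sh (maximalIdeal R)).symm.toLinearMap
  have hψ : ∀ (s : Sh) (x : maximalIdeal R), ψ (s ⊗ₜ[R] x) = s ⊗ₜ[Rh] ι x := fun s x => by
    simp [ψ]
  -- every element of `S^ ⊗_{R^} 𝔪_{R^}` comes from `S^ ⊗_R 𝔪_R`
  have hsurj : ∀ z : Sh ⊗[Rh] maximalIdeal Rh, ∃ w, ψ w = z := by
    intro z
    induction z using TensorProduct.induction_on with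
    | zero => exact ⟨0, map_zero ψ⟩
    | tmul s y =>
      have hy₂ : (y : Rh) ∈ Ideal.span (Set.range fun i => algebraMap R Rh (v i)) := by
        rw [← hgen]; exact y.2
      obtain ⟨c, hc⟩ := Ideal.mem_span_range_iff_exists_fun.mp hy₂
      refine ⟨∑ i, (c i • s) ⊗ₜ[R] (⟨v i, hvmem i⟩ : maximalIdeal R), ?_⟩
      have hy : y = ∑ i, c i • ι ⟨v i, hvmem i⟩ := by
        apply Subtype.ext
        rw [← hc, Submodule.coe_sum]
        refine Finset.sum_congr rfl fun i _ => ?_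
        rw [Submodule.coe_smul, smul_eq_mul]
        rfl
      rw [map_sum, hy, tmul_sum]
      refine Finset.sum_congr rfl fun i _ => ?_
      rw [hψ, tmul_smul, smul_tmul']
    | add z₁ z₂ h₁ h₂ =>
      obtain ⟨w₁, rfl⟩ := h₁
      obtain ⟨w₂, rfl⟩ := h₂
      exact ⟨w₁ + w₂, map_add ψ w₁ w₂⟩
  -- on `S^ ⊗_R 𝔪_R` the map is the multiplication map, injective by flatness of `S^` over `R`
  have hcomm : ∀ w : Sh ⊗[R] maximalIdeal R,
      TensorProduct.rid Rh Sh (LinearMap.lTensor Sh (maximalIdeal Rh).subtype (ψ w)) =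
        TensorProduct.rid R Sh (LinearMap.lTensor Sh (maximalIdeal R).subtype w) := by
    intro w
    induction w using TensorProduct.induction_on with
    | zero => simp
    | tmul s x =>
      rw [hψ, LinearMap.lTensor_tmul, LinearMap.lTensor_tmul, TensorProduct.rid_tmul,
        TensorProduct.rid_tmul, Submodule.subtype_apply, Submodule.subtype_apply, hι,
        algebraMap_smul]
    | add w₁ w₂ h₁ h₂ => simp only [map_add, h₁, h₂]
  have hinjR : Function.Injective (LinearMap.lTensor Sh (maximalIdeal R).subtype) :=
    Module.Flat.lTensor_preserves_injective_linearMap _ Subtype.val_injective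
  rw [injective_iff_map_eq_zero]
  intro z hz
  obtain ⟨w, rfl⟩ := hsurj z
  have hw : LinearMap.lTensor Sh (maximalIdeal R).subtype w = 0 := by
    apply (TensorProduct.rid R Sh).injective
    rw [← hcomm, hz, map_zero, map_zero]
  rw [hinjR (hw.trans (map_zero _).symm), map_zero]

/-- **"`f^*` is faithfully flat"** (Matsumura, proof of Thm. 32.2 (ii)): the completed map of a
flat local homomorphism of Noetherian local rings is faithfully flat (flat and local).
[cite: Matsumura1987, Thm. 32.2 (ii), proof] -/
theorem faithfullyFlat_adicCompletionMap [Module.Flat R S]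
    (h : (maximalIdeal R).map (algebraMap R S) ≤ maximalIdeal S) :
    (adicCompletionMap (maximalIdeal R) (maximalIdeal S) (algebraMap R S) h).FaithfullyFlat := by
  set fh := adicCompletionMap (maximalIdeal R) (maximalIdeal S) (algebraMap R S) h
  letI : Algebra (AdicCompletion (maximalIdeal R) R) (AdicCompletion (maximalIdeal S) S) :=
    fh.toAlgebra
  haveI : Module.Flat (AdicCompletion (maximalIdeal R) R) (AdicCompletion (maximalIdeal S) S) :=
    flat_adicCompletionMap h
  haveI : IsLocalHom (algebraMap (AdicCompletion (maximalIdeal R) R)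
      (AdicCompletion (maximalIdeal S) S)) := isLocalHom_adicCompletionMap h
  change Module.FaithfullyFlat (AdicCompletion (maximalIdeal R) R) (AdicCompletion (maximalIdeal S) S)
  exact Module.FaithfullyFlat.of_flat_of_isLocalHom

end CompletedMap

end Literature.AlgebraicGeometry.Resolution

end
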